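import Literature.AlgebraicGeometry.ModuliOfAbelianVarieties.SiegelComplexRecordSystem
import HarnessLib

/-!
# Multipliers on the principal levels `K_δ(N)`: `ν(K_δ(N)) = 𝓞̂^× ∩ (1 + N·𝓞̂)`

Informal companion: [[SiegelPrincipalLevelMultiplier.md]] (this file is the Lean half).

For the adelic symplectic similitude group `GSp_δ(𝔸_{ℚ,f})` of type `δ` (★ `gspFinAdelic δ`, multiplier RELATION
★ `IsMultiplier`) and its principal congruence subgroups `K_δ(N)` (★ `principalLevelSubgroup δ N`, «`γ ≡ 1, γ⁻¹ ≡ 1 mod N·𝓞̂`»)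
we prove the multiplier side of the piece index of `Sh_{K_δ(N)} = ∐ Γ∖𝔥_g` ([Del71] 4.16, [MilISV] §6 p. 70,
`π₀ = ℚ^×∖𝔸_f^×/ν(K)`):

* §1 congruences: for an INTEGRAL Gram matrix `E` and `γ ≡ 1 (mod N)`, every entry of `ᵗγ E γ - E` lies in `N·𝓞̂`;
  hence a multiplier `ν` of `γ` satisfies `(ν - 1)·E_{ab} ∈ N·𝓞̂` for all entries (`natCast_mul_sub_one_mem_levelIdeal_of_isMultiplier`
  for `E = E_δ`: `δᵢ (ν - 1) ∈ N·𝓞̂`);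
* §2 `ν(K_δ(N)) ⊆ 1 + N·𝓞̂`: if some `δ_{i₀} > 0` divides every `δ_j` (e.g. `δ` a polarisation type, `i₀ = 0`), then
  `ν - 1 ∈ N·𝓞̂` and `ν⁻¹ - 1 ∈ N·𝓞̂` (run §1 with the integral form `δ_{i₀}⁻¹ E_δ`, whose `(i₀, g + i₀)` entry is `1`);
* §3 `ν(K_δ(N)) ⊇ 𝓞̂^× ∩ (1 + N·𝓞̂)`: the section `u ↦ diag(1_g, u·1_g) ∈ K_δ(N)` has multiplier `u`.
-/

open Matrix NumberField IsDedekindDomain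

namespace Literature.AlgebraicGeometry.ModuliOfAbelianVarieties

variable {g : ℕ}

/-! ### §1. Congruences for `ᵗγ E γ` with `γ ≡ 1 (mod N)` and `E` integral -/

section Congruence

variable {n : Type} [Fintype n] [DecidableEq n] {N : ℕ}

omit [DecidableEq n] in
/-- `A` integral, `X ≡ 0 (mod N)` entrywise `⇒ A·X ≡ 0 (mod N)` entrywise. [cite: Deligne1971TravauxShimura, Exemple 4.16 p. 150] -/
theorem mul_apply_mem_levelIdeal_of_left {A X : Matrix n n finAdeleQ}
    (hA : ∀ a b, A a b ∈ FiniteAdeleRing.integralAdeles (𝓞 ℚ) ℚ) (hX : ∀ a b, X a b ∈ levelIdeal N) (a b : n) :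
    (A * X) a b ∈ levelIdeal N := by
  rw [Matrix.mul_apply]
  exact sum_mem fun k _ => mul_mem_levelIdeal_of_mem_integralAdeles (hA a k) (hX k b)

omit [DecidableEq n] in
/-- `X ≡ 0 (mod N)` entrywise, `A` integral `⇒ X·A ≡ 0 (mod N)` entrywise. [cite: Deligne1971TravauxShimura, Exemple 4.16 p. 150] -/
theorem mul_apply_mem_levelIdeal_of_right {A X : Matrix n n finAdeleQ}
    (hX : ∀ a b, X a b ∈ levelIdeal N) (hA : ∀ a b, A a b ∈ FiniteAdeleRing.integralAdeles (𝓞 ℚ) ℚ) (a b : n) :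
    (X * A) a b ∈ levelIdeal N := by
  rw [Matrix.mul_apply]
  exact sum_mem fun k _ => by
    rw [mul_comm]
    exact mul_mem_levelIdeal_of_mem_integralAdeles (hA k b) (hX a k)

/-- **`γ ≡ 1 (mod N)`, `E` integral `⇒ ᵗγ E γ ≡ E (mod N·𝓞̂)`**: with `X = γ - 1`,
`ᵗγ E γ - E = ᵗX E + E X + ᵗX E X`. [cite: Deligne1971TravauxShimura, Exemple 4.16 p. 150] -/
theorem transpose_mul_mul_sub_apply_mem_levelIdeal {E G : Matrix n n finAdeleQ}
    (hE : ∀ a b, E a b ∈ FiniteAdeleRing.integralAdeles (𝓞 ℚ) ℚ) (hG : IsCongOne N G) (a b : n) :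
    (Gᵀ * E * G - E) a b ∈ levelIdeal N := by
  have hX : ∀ a b, (G - 1) a b ∈ levelIdeal N := hG
  have hXt : ∀ a b, (G - 1)ᵀ a b ∈ levelIdeal N := fun a b => hX b a
  have hXi : ∀ a b, (G - 1) a b ∈ FiniteAdeleRing.integralAdeles (𝓞 ℚ) ℚ :=
    fun a b => mem_integralAdeles_of_mem_levelIdeal (hX a b)
  have hexp : Gᵀ * E * G - E = (G - 1)ᵀ * E + E * (G - 1) + (G - 1)ᵀ * E * (G - 1) := by
    have hG1 : G = 1 + (G - 1) := by abel
    conv_lhs => rw [hG1]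
    rw [Matrix.transpose_add, Matrix.transpose_one]
    noncomm_ring
  rw [hexp, Matrix.add_apply, Matrix.add_apply]
  refine add_mem (add_mem (mul_apply_mem_levelIdeal_of_right hXt hE a b) (mul_apply_mem_levelIdeal_of_left hE hX a b)) ?_
  exact mul_apply_mem_levelIdeal_of_left
    (fun a b => mem_integralAdeles_of_mem_levelIdeal (mul_apply_mem_levelIdeal_of_right hXt hE a b)) hX a b

/-- **A multiplier of `γ ≡ 1 (mod N)` for an integral form satisfies `(ν - 1)·E_{ab} ∈ N·𝓞̂`** for every entry.
[cite: Deligne1971TravauxShimura, Exemple 4.16 p. 150] [cite: Milne2005ShimuraVarieties, §6 p. 67] -/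
theorem sub_one_mul_apply_mem_levelIdeal_of_isMultiplier {E : Matrix n n finAdeleQ} {G : GL n finAdeleQ} {ν : finAdeleQˣ}
    (hE : ∀ a b, E a b ∈ FiniteAdeleRing.integralAdeles (𝓞 ℚ) ℚ) (hG : IsCongOne N (G : Matrix n n finAdeleQ))
    (hν : IsMultiplier E G ν) (a b : n) : ((ν : finAdeleQ) - 1) * E a b ∈ levelIdeal N := by
  have h := transpose_mul_mul_sub_apply_mem_levelIdeal hE hG a b
  rw [hν, Matrix.sub_apply, Matrix.smul_apply, smul_eq_mul] at h
  rwa [sub_mul, one_mul]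

end Congruence

/-! ### §2. `ν(K_δ(N)) ⊆ 1 + N·𝓞̂` -/

section LevelMultiplier

variable (δ : Fin g → ℕ) {N : ℕ}

/-- The entries of `E_δ` over `𝔸_{ℚ,f}` are integral (casts of integers). [cite: GenestierNgo2020, §1.2] -/
theorem typeFormOver_apply_mem_integralAdeles (a b : Fin g ⊕ Fin g) :
    typeFormOver δ finAdeleQ a b ∈ FiniteAdeleRing.integralAdeles (𝓞 ℚ) ℚ := by
  rw [typeFormOver_apply]
  exact intCast_mem _ _

/-- `(E_δ)_{i, g+i} = δᵢ`. [cite: GenestierNgo2020, §1.2] -/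
theorem typeFormOver_inl_inr (R : Type) [CommRing R] (i : Fin g) :
    typeFormOver δ R (Sum.inl i) (Sum.inr i) = (δ i : R) := by
  rw [typeFormOver_apply, typeForm, Matrix.fromBlocks_apply₁₂, Matrix.diagonal_apply_eq, Int.cast_natCast]

/-- **`δᵢ·(ν - 1) ∈ N·𝓞̂`** for every multiplier `ν` of an element of `K_δ(N)` and every `i`.
[cite: Deligne1971TravauxShimura, Exemple 4.16 p. 150] [cite: Milne2005ShimuraVarieties, §6 p. 70] -/
theorem natCast_mul_sub_one_mem_levelIdeal_of_isMultiplier {γ : ↥(gspFinAdelic δ)} (hγ : γ ∈ principalLevelSubgroup δ N)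
    {ν : finAdeleQˣ} (hν : IsMultiplier (typeFormOver δ finAdeleQ) (γ : GL (Fin g ⊕ Fin g) finAdeleQ) ν) (i : Fin g) :
    (δ i : finAdeleQ) * ((ν : finAdeleQ) - 1) ∈ levelIdeal N := by
  rw [mul_comm, ← typeFormOver_inl_inr δ finAdeleQ i]
  exact sub_one_mul_apply_mem_levelIdeal_of_isMultiplier (typeFormOver_apply_mem_integralAdeles δ) hγ.1 hν _ _

/-- **`ν(K_δ(N)) ⊆ 1 + N·𝓞̂`**: if `δ_{i₀} > 0` divides every `δ_j`, a multiplier `ν` of `γ ∈ K_δ(N)` satisfies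
`ν - 1 ∈ N·𝓞̂` (apply §1 to the INTEGRAL form `δ_{i₀}⁻¹·E_δ`, whose `(i₀, g+i₀)` entry is `1`; `δ_{i₀}` is a unit of
`𝔸_{ℚ,f}`). [cite: Deligne1971TravauxShimura, Exemple 4.16 p. 150] [cite: Milne2005ShimuraVarieties, §6 p. 70] -/
theorem sub_one_mem_levelIdeal_of_isMultiplier {γ : ↥(gspFinAdelic δ)} (hγ : γ ∈ principalLevelSubgroup δ N)
    {ν : finAdeleQˣ} (hν : IsMultiplier (typeFormOver δ finAdeleQ) (γ : GL (Fin g ⊕ Fin g) finAdeleQ) ν)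
    (i₀ : Fin g) (h0 : 0 < δ i₀) (hdvd : ∀ j, δ i₀ ∣ δ j) : (ν : finAdeleQ) - 1 ∈ levelIdeal N := by
  -- the unit `c = δ_{i₀}` of `𝔸_{ℚ,f}` and the integral form `E' = c⁻¹ E_δ`
  let c : finAdeleQˣ := Units.map (algebraMap ℚ finAdeleQ : ℚ →* finAdeleQ)
    (Units.mk0 (δ i₀ : ℚ) (Nat.cast_ne_zero.2 (Nat.pos_iff_ne_zero.1 h0)))
  have hc : (c : finAdeleQ) = (δ i₀ : finAdeleQ) := by
    change algebraMap ℚ finAdeleQ (δ i₀ : ℚ) = _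
    rw [map_natCast]
  have hE' : ∀ a b, (((c⁻¹ : finAdeleQˣ) : finAdeleQ) • typeFormOver δ finAdeleQ) a b ∈
      FiniteAdeleRing.integralAdeles (𝓞 ℚ) ℚ := by
    have hdiag : ∀ j, ((c⁻¹ : finAdeleQˣ) : finAdeleQ) * (δ j : finAdeleQ) ∈ FiniteAdeleRing.integralAdeles (𝓞 ℚ) ℚ := by
      intro j
      obtain ⟨k, hk⟩ := hdvd j
      rw [hk, Nat.cast_mul, ← hc, Units.inv_mul_cancel_left]
      exact natCast_mem _ k
    rintro (i | i) (j | j)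
    · rw [Matrix.smul_apply, typeFormOver_apply, typeForm, Matrix.fromBlocks_apply₁₁, Matrix.zero_apply, Int.cast_zero,
        smul_zero]
      exact zero_mem _
    · rw [Matrix.smul_apply, typeFormOver_apply, typeForm, Matrix.fromBlocks_apply₁₂, Matrix.diagonal_apply, smul_eq_mul]
      by_cases hij : i = j
      · rw [if_pos hij, Int.cast_natCast]; exact hdiag i
      · rw [if_neg hij, Int.cast_zero, mul_zero]; exact zero_mem _
    · rw [Matrix.smul_apply, typeFormOver_apply, typeForm, Matrix.fromBlocks_apply₂₁, Matrix.neg_apply, Matrix.diagonal_apply,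
        smul_eq_mul]
      by_cases hij : i = j
      · rw [if_pos hij, Int.cast_neg, Int.cast_natCast, mul_neg]; exact neg_mem (hdiag i)
      · rw [if_neg hij, neg_zero, Int.cast_zero, mul_zero]; exact zero_mem _
    · rw [Matrix.smul_apply, typeFormOver_apply, typeForm, Matrix.fromBlocks_apply₂₂, Matrix.zero_apply, Int.cast_zero,
        smul_zero]
      exact zero_mem _
  have hν' : IsMultiplier (((c⁻¹ : finAdeleQˣ) : finAdeleQ) • typeFormOver δ finAdeleQ) (γ : GL (Fin g ⊕ Fin g) finAdeleQ) ν := by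
    rw [isMultiplier_iff] at hν ⊢
    rw [Matrix.mul_smul, Matrix.smul_mul, hν, smul_comm]
  have h := sub_one_mul_apply_mem_levelIdeal_of_isMultiplier hE' hγ.1 hν' (Sum.inl i₀) (Sum.inr i₀)
  rwa [Matrix.smul_apply, typeFormOver_inl_inr, ← hc, smul_eq_mul, Units.inv_mul, mul_one] at h

/-- … and `ν⁻¹ - 1 ∈ N·𝓞̂` (the same for `γ⁻¹ ∈ K_δ(N)`, multiplier `ν⁻¹`). [cite: Deligne1971TravauxShimura, Exemple 4.16 p. 150] -/
theorem inv_sub_one_mem_levelIdeal_of_isMultiplier {γ : ↥(gspFinAdelic δ)} (hγ : γ ∈ principalLevelSubgroup δ N)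
    {ν : finAdeleQˣ} (hν : IsMultiplier (typeFormOver δ finAdeleQ) (γ : GL (Fin g ⊕ Fin g) finAdeleQ) ν)
    (i₀ : Fin g) (h0 : 0 < δ i₀) (hdvd : ∀ j, δ i₀ ∣ δ j) : ((ν⁻¹ : finAdeleQˣ) : finAdeleQ) - 1 ∈ levelIdeal N :=
  sub_one_mem_levelIdeal_of_isMultiplier δ (Subgroup.inv_mem _ hγ) (by rw [Subgroup.coe_inv]; exact hν.inv) i₀ h0 hdvd

/-- **Polarisation types**: for `δ₁ ∣ δ₂ ∣ ⋯ ∣ δ_g` (★ `IsPolarizationType δ`) and `0 < g`, every multiplier `ν` of an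
element of `K_δ(N)` satisfies `ν ≡ 1` and `ν⁻¹ ≡ 1 (mod N·𝓞̂)`, i.e. `ν ∈ 𝓞̂^× ∩ (1 + N·𝓞̂)`.
[cite: Deligne1971TravauxShimura, Exemple 4.16 p. 150] [cite: Milne2005ShimuraVarieties, §6 p. 70] -/
theorem sub_one_mem_levelIdeal_of_isMultiplier_of_isPolarizationType (hδ : IsPolarizationType δ) (hg : 0 < g)
    {γ : ↥(gspFinAdelic δ)} (hγ : γ ∈ principalLevelSubgroup δ N) {ν : finAdeleQˣ}
    (hν : IsMultiplier (typeFormOver δ finAdeleQ) (γ : GL (Fin g ⊕ Fin g) finAdeleQ) ν) :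
    (ν : finAdeleQ) - 1 ∈ levelIdeal N ∧ ((ν⁻¹ : finAdeleQˣ) : finAdeleQ) - 1 ∈ levelIdeal N :=
  ⟨sub_one_mem_levelIdeal_of_isMultiplier δ hγ hν ⟨0, hg⟩ (hδ.1 _) fun _ => hδ.2 _ _ (Fin.mk_le_mk.2 (Nat.zero_le _)),
    inv_sub_one_mem_levelIdeal_of_isMultiplier δ hγ hν ⟨0, hg⟩ (hδ.1 _) fun _ => hδ.2 _ _ (Fin.mk_le_mk.2 (Nat.zero_le _))⟩

end LevelMultiplier

/-! ### §3. `ν(K_δ(N)) ⊇ 𝓞̂^× ∩ (1 + N·𝓞̂)`: the section `u ↦ diag(1_g, u·1_g)` -/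

section Section

variable (δ : Fin g → ℕ) {N : ℕ}

/-- `E_δ` over `R` in block form. [cite: GenestierNgo2020, §1.2] -/
theorem typeFormOver_eq_fromBlocks (R : Type) [CommRing R] :
    typeFormOver δ R = Matrix.fromBlocks 0 (Matrix.diagonal fun i => (δ i : R)) (-Matrix.diagonal fun i => (δ i : R)) 0 := by
  ext a b
  rcases a with i | i <;> rcases b with j | j
  · rw [typeFormOver_apply, typeForm, Matrix.fromBlocks_apply₁₁, Matrix.fromBlocks_apply₁₁, Matrix.zero_apply,
      Matrix.zero_apply, Int.cast_zero]
  · rw [typeFormOver_apply, typeForm, Matrix.fromBlocks_apply₁₂, Matrix.fromBlocks_apply₁₂, Matrix.diagonal_apply,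
      Matrix.diagonal_apply]
    by_cases hij : i = j
    · rw [if_pos hij, if_pos hij, Int.cast_natCast]
    · rw [if_neg hij, if_neg hij, Int.cast_zero]
  · rw [typeFormOver_apply, typeForm, Matrix.fromBlocks_apply₂₁, Matrix.fromBlocks_apply₂₁, Matrix.neg_apply,
      Matrix.neg_apply, Matrix.diagonal_apply, Matrix.diagonal_apply]
    by_cases hij : i = j
    · rw [if_pos hij, if_pos hij, Int.cast_neg, Int.cast_natCast]
    · rw [if_neg hij, if_neg hij, neg_zero, neg_zero, Int.cast_zero]
  · rw [typeFormOver_apply, typeForm, Matrix.fromBlocks_apply₂₂, Matrix.fromBlocks_apply₂₂, Matrix.zero_apply,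
      Matrix.zero_apply, Int.cast_zero]

/-- **The section `u ↦ diag(1_g, u·1_g)`**: for `u ∈ 𝓞̂^×` with `u ≡ 1 (mod N)` (i.e. `u - 1, u⁻¹ - 1 ∈ N·𝓞̂`) the block
matrix `diag(1_g, u·1_g)` lies in `K_δ(N)` and has multiplier `u`; hence `ν : K_δ(N) → 𝓞̂^× ∩ (1 + N·𝓞̂)` is onto.
[cite: Deligne1971TravauxShimura, Exemple 4.16 p. 150] [cite: Milne2005ShimuraVarieties, §6 p. 70] -/
theorem exists_mem_principalLevelSubgroup_isMultiplier (u : finAdeleQˣ) (hu : (u : finAdeleQ) - 1 ∈ levelIdeal N)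
    (hu' : ((u⁻¹ : finAdeleQˣ) : finAdeleQ) - 1 ∈ levelIdeal N) :
    ∃ γ ∈ principalLevelSubgroup δ N, IsMultiplier (typeFormOver δ finAdeleQ) (γ : GL (Fin g ⊕ Fin g) finAdeleQ) u ∧
      ((γ : GL (Fin g ⊕ Fin g) finAdeleQ) : Matrix (Fin g ⊕ Fin g) (Fin g ⊕ Fin g) finAdeleQ) =
        Matrix.fromBlocks 1 0 0 ((u : finAdeleQ) • (1 : Matrix (Fin g) (Fin g) finAdeleQ)) := by
  -- the element of `GL_{2g}(𝔸_{ℚ,f})`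
  let Γ : GL (Fin g ⊕ Fin g) finAdeleQ :=
    { val := Matrix.fromBlocks 1 0 0 ((u : finAdeleQ) • (1 : Matrix (Fin g) (Fin g) finAdeleQ))
      inv := Matrix.fromBlocks 1 0 0 (((u⁻¹ : finAdeleQˣ) : finAdeleQ) • (1 : Matrix (Fin g) (Fin g) finAdeleQ))
      val_inv := by
        rw [Matrix.fromBlocks_multiply]
        simp [smul_smul, Matrix.fromBlocks_one]
      inv_val := by
        rw [Matrix.fromBlocks_multiply]
        simp [smul_smul, Matrix.fromBlocks_one] }
  have hΓ : (Γ : Matrix (Fin g ⊕ Fin g) (Fin g ⊕ Fin g) finAdeleQ) =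
      Matrix.fromBlocks 1 0 0 ((u : finAdeleQ) • (1 : Matrix (Fin g) (Fin g) finAdeleQ)) := rfl
  have hΓinv : ((Γ⁻¹ : GL (Fin g ⊕ Fin g) finAdeleQ) : Matrix (Fin g ⊕ Fin g) (Fin g ⊕ Fin g) finAdeleQ) =
      Matrix.fromBlocks 1 0 0 (((u⁻¹ : finAdeleQˣ) : finAdeleQ) • (1 : Matrix (Fin g) (Fin g) finAdeleQ)) := rfl
  -- multiplier `u`
  have hmult : IsMultiplier (typeFormOver δ finAdeleQ) Γ u := by
    rw [isMultiplier_iff, hΓ, typeFormOver_eq_fromBlocks, Matrix.fromBlocks_transpose, Matrix.transpose_one,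
      Matrix.transpose_zero, Matrix.transpose_smul, Matrix.transpose_one,
      Matrix.fromBlocks_multiply, Matrix.fromBlocks_multiply, Matrix.fromBlocks_smul]
    simp
  -- congruence `≡ 1 (mod N)` of a block matrix `diag(1, v·1)` with `v - 1 ∈ N·𝓞̂`
  have hcong : ∀ v : finAdeleQ, v - 1 ∈ levelIdeal N →
      IsCongOne N (Matrix.fromBlocks (1 : Matrix (Fin g) (Fin g) finAdeleQ) 0 0 (v • (1 : Matrix (Fin g) (Fin g) finAdeleQ))) := by
    intro v hv a b
    rcases a with i | i <;> rcases b with j | j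
    · rw [Matrix.sub_apply, Matrix.fromBlocks_apply₁₁, Matrix.one_apply, Matrix.one_apply]
      by_cases hij : i = j
      · rw [if_pos hij, if_pos (congrArg Sum.inl hij), sub_self]; exact zero_mem _
      · rw [if_neg hij, if_neg (fun h => hij (Sum.inl_injective h)), sub_zero]; exact zero_mem _
    · rw [Matrix.sub_apply, Matrix.fromBlocks_apply₁₂, Matrix.zero_apply, Matrix.one_apply_ne Sum.inl_ne_inr, sub_zero]
      exact zero_mem _
    · rw [Matrix.sub_apply, Matrix.fromBlocks_apply₂₁, Matrix.zero_apply, Matrix.one_apply_ne Sum.inr_ne_inl, sub_zero]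
      exact zero_mem _
    · rw [Matrix.sub_apply, Matrix.fromBlocks_apply₂₂, Matrix.smul_apply, Matrix.one_apply, Matrix.one_apply]
      by_cases hij : i = j
      · rw [if_pos hij, if_pos (congrArg Sum.inr hij), smul_eq_mul, mul_one]; exact hv
      · rw [if_neg hij, if_neg (fun h => hij (Sum.inr_injective h)), smul_zero, sub_zero]; exact zero_mem _
  refine ⟨⟨Γ, ⟨u, hmult⟩⟩, ?_, hmult, hΓ⟩
  rw [mem_principalLevelSubgroup_iff]
  refine ⟨hcong _ hu, ?_⟩
  change IsCongOne N ((Γ⁻¹ : GL (Fin g ⊕ Fin g) finAdeleQ) : Matrix (Fin g ⊕ Fin g) (Fin g ⊕ Fin g) finAdeleQ)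
  rw [hΓinv]
  exact hcong _ hu'

end Section

end Literature.AlgebraicGeometry.ModuliOfAbelianVarieties
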